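import Mathlib
import Summits.KontsevichZagierPeriods.Zeta5Search.BrickLucasAssembly

/-!
# BrickDepthOneCell — the DEPTH-ONE CELL in closed form: `c_{k,A−1}(n) = c_{k,A}(n)·[ε/(n/2−k) + (A+B)(H_k − H_{n−k})
+ B(H_{2n−k} − H_{n+k})]` (the logarithmic derivative of the regular part of the brick kernel at the pole `−k`)
(cell zeta5-irr)

HONEST FRAMING: systematic search; no irrationality claim unless certified. INSTRUMENT-tier arithmetic of the ζ(5)
census cell zeta5-irr (HOME `run/shared/lean/pub/zeta5-irr/`), filed by the engine seat zi-eng (g13). WHAT THIS IS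
NOT: nothing about ζ(5); 0 nats/n; rung F-Z1 NOT moved. Plumbing for the strip-sum law (V) of
`BrickLucasAssembly.lucas_of_blockLaws` (the cross-row comparison of the strip derivative needs the depth-one cell of
the one-digit row explicitly).

## The statement (`laurent_one_eq`)

For the brick kernel `R_n^{(A,B,ε)}(t) = n!^{A−2B}(t + n/2)^ε∏_{m=1}^{n}(t−m)^B∏_{m=1}^{n}(t+n+m)^B/∏_{m=0}^{n}(t+m)^A`,
`ε ≤ 1`, a pole `k ≤ n` off the exact centre (`2k ≠ n ∨ ε = 0`), with `H_x = Σ_{i≤x} 1/i` (`BrickHarmonicBlocks.hsum 1`):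
**`laurent A B ε n k 1 = cTop A B ε n k · (ε/(n/2 − k) + (A+B)·(H_k − H_{n−k}) + B·(H_{2n−k} − H_{n+k}))`**
— `[T¹]` of `F_k(T) = T^A R_n(−k+T)` is `F_k(0)` times the logarithmic derivative at `T = 0` of the regular part
`(T + n/2 − k)^ε ∏(T − k − m)^B ∏(T + n − k + m)^B / ∏_{m≠k}(T + m − k)^A`, i.e. `ε/(n/2−k) − BΣ1/(k+m) + BΣ1/(n−k+m)
− AΣ_{m≠k}1/(m−k)`, and `Σ_{m=1}^{n}1/(k+m) = H_{n+k} − H_k`, `Σ_{m=1}^{n}1/(n−k+m) = H_{2n−k} − H_{n−k}`,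
`Σ_{m≤n, m≠k}1/(m−k) = H_{n−k} − H_k`. Generic tools: first two coefficients of products of linear factors
(`coeff_prod_X_add_C`), of powers (`coeff_one_pow`), of products (`coeff_one_mul`).
-/

namespace Summit.KontsevichZagierPeriods.Zeta5Search.BrickDepthOneCell

open Finset Nat Polynomial
open Summit.KontsevichZagierPeriods.Zeta5Search.BrickTopCoefficient (cTop)
open Summit.KontsevichZagierPeriods.Zeta5Search.BrickLaurent (expandAt laurentSeries laurent kerNum kerDenErase
  laurent_zero constantCoeff_coe_taylor eval_kerDenErase_neg_ne_zero)
open Summit.KontsevichZagierPeriods.Zeta5Search.BrickLaurentValuation (taylor_kerNum taylor_kerDenErase)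
open Summit.KontsevichZagierPeriods.Zeta5Search.BrickHarmonicBlocks (hsum hsum_add)

noncomputable section

/-! ## First two coefficients of products -/

/-- `[X⁰]` and `[X¹]` of a product: `(FG)₀ = F₀G₀`, `(FG)₁ = F₀G₁ + F₁G₀`. -/
theorem coeff_zero_one_mul (F G : ℚ[X]) :
    (F * G).coeff 0 = F.coeff 0 * G.coeff 0 ∧ (F * G).coeff 1 = F.coeff 0 * G.coeff 1 + F.coeff 1 * G.coeff 0 := by
  refine ⟨mul_coeff_zero F G, ?_⟩
  rw [coeff_mul, Finset.Nat.sum_antidiagonal_succ, Finset.Nat.antidiagonal_zero, Finset.sum_singleton]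

/-- LOGARITHMIC DERIVATIVE OF A PRODUCT: `(FG)₁ = (FG)₀·(F₁/F₀ + G₁/G₀)` when `F₀, G₀ ≠ 0`. -/
theorem coeff_one_mul {F G : ℚ[X]} (hF : F.coeff 0 ≠ 0) (hG : G.coeff 0 ≠ 0) :
    (F * G).coeff 1 = (F * G).coeff 0 * (F.coeff 1 / F.coeff 0 + G.coeff 1 / G.coeff 0) := by
  obtain ⟨h0, h1⟩ := coeff_zero_one_mul F G
  rw [h1, h0]
  field_simp
  ring

/-- LOGARITHMIC DERIVATIVE OF A POWER: `(F^B)₀ = F₀^B` and `(F^B)₁ = (F^B)₀·(B·F₁/F₀)` when `F₀ ≠ 0`. -/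
theorem coeff_one_pow {F : ℚ[X]} (hF : F.coeff 0 ≠ 0) (B : ℕ) :
    (F ^ B).coeff 0 = F.coeff 0 ^ B ∧ (F ^ B).coeff 1 = (F ^ B).coeff 0 * (B * (F.coeff 1 / F.coeff 0)) := by
  induction B with
  | zero => simp [Polynomial.coeff_one]
  | succ B ih =>
    obtain ⟨ih0, ih1⟩ := ih
    have hB0 : (F ^ B).coeff 0 ≠ 0 := by rw [ih0]; exact pow_ne_zero _ hF
    refine ⟨by rw [pow_succ, mul_coeff_zero, ih0, pow_succ], ?_⟩
    rw [pow_succ, coeff_one_mul hB0 hF, ih1, mul_coeff_zero]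
    field_simp
    push_cast
    ring

/-- A PRODUCT OF LINEAR FACTORS: `[X⁰]∏(X + r_i) = ∏ r_i` and, if no `r_i` vanishes,
`[X¹]∏(X + r_i) = (∏ r_i)·Σ 1/r_i`. -/
theorem coeff_prod_X_add_C {ι : Type*} [DecidableEq ι] (s : Finset ι) (r : ι → ℚ) (hr : ∀ i ∈ s, r i ≠ 0) :
    (∏ i ∈ s, (X + C (r i))).coeff 0 = ∏ i ∈ s, r i ∧
      (∏ i ∈ s, (X + C (r i))).coeff 1 = (∏ i ∈ s, r i) * ∑ i ∈ s, (r i)⁻¹ := by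
  induction s using Finset.induction_on with
  | empty => simp [Polynomial.coeff_one]
  | insert a s ha ih =>
    obtain ⟨ih0, ih1⟩ := ih fun i hi => hr i (Finset.mem_insert_of_mem hi)
    have hra : r a ≠ 0 := hr a (Finset.mem_insert_self a s)
    obtain ⟨h0, h1⟩ := coeff_zero_one_mul (X + C (r a)) (∏ i ∈ s, (X + C (r i)))
    have hl0 : (X + C (r a) : ℚ[X]).coeff 0 = r a := by simp
    have hl1 : (X + C (r a) : ℚ[X]).coeff 1 = 1 := by simp [coeff_X_one]
    rw [Finset.prod_insert ha, Finset.prod_insert ha, Finset.sum_insert ha, h0, h1, ih0, ih1, hl0, hl1]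
    refine ⟨rfl, ?_⟩
    field_simp
    ring

/-! ## The three offset families as harmonic differences -/

/-- `Σ_{m=1}^{n} 1/(k+m) = H_{n+k} − H_k`. -/
theorem sum_inv_add_eq (k n : ℕ) :
    ∑ m ∈ Icc 1 n, ((k : ℚ) + m)⁻¹ = hsum 1 (n + k) - hsum 1 k := by
  rw [show n + k = k + n by ring, hsum_add 1 k n]
  simp only [pow_one, one_div, Nat.cast_add, add_sub_cancel_left]

/-- `Σ_{m=1}^{n} 1/(n−k+m) = H_{2n−k} − H_{n−k}` (`k ≤ n`). -/
theorem sum_inv_sub_add_eq {k n : ℕ} (hk : k ≤ n) :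
    ∑ m ∈ Icc 1 n, ((n : ℚ) + m - k)⁻¹ = hsum 1 (2 * n - k) - hsum 1 (n - k) := by
  rw [show 2 * n - k = (n - k) + n by omega, hsum_add 1 (n - k) n]
  simp only [pow_one, one_div, Nat.cast_add, Nat.cast_sub hk, add_sub_cancel_left]
  exact Finset.sum_congr rfl fun m _ => by ring

/-- `Σ_{m ≤ n, m ≠ k} 1/(m−k) = H_{n−k} − H_k` (`k ≤ n`). -/
theorem sum_inv_sub_eq {k n : ℕ} (hk : k ≤ n) :
    ∑ m ∈ (range (n + 1)).erase k, ((m : ℚ) - k)⁻¹ = hsum 1 (n - k) - hsum 1 k := by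
  have hk' : k ∈ range (n + 1) := mem_range.2 (by omega)
  rw [Finset.sum_erase_eq_sub hk', sub_self, inv_zero, sub_zero, Finset.range_eq_Ico,
    ← Finset.sum_Ico_consecutive _ (Nat.zero_le k) (by omega : k ≤ n + 1), Finset.sum_Ico_eq_sum_range,
    Finset.sum_Ico_eq_sum_range, show n + 1 - k = (n - k) + 1 by omega, Finset.sum_range_succ']
  -- the left part is `−H_k`, the right part is `H_{n−k}`
  have hleft : ∑ x ∈ range (k - 0), ((((0 + x : ℕ) : ℚ)) - k)⁻¹ = -hsum 1 k := by
    rw [Nat.sub_zero, hsum, ← Finset.sum_range_reflect, show Icc 1 k = Ico 1 (k + 1) by rfl,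
      Finset.sum_Ico_eq_sum_range, Nat.add_sub_cancel, ← Finset.sum_neg_distrib]
    refine Finset.sum_congr rfl fun j hj => ?_
    have hj' := mem_range.1 hj
    rw [pow_one, one_div, ← inv_neg]
    congr 1
    push_cast [show j ≤ k - 1 by omega, show 1 ≤ k by omega]
    ring
  have hright : ∑ x ∈ range (n - k), ((((k + (x + 1) : ℕ) : ℚ)) - k)⁻¹ = hsum 1 (n - k) := by
    rw [hsum, show Icc 1 (n - k) = Ico 1 (n - k + 1) by rfl, Finset.sum_Ico_eq_sum_range, Nat.add_sub_cancel]
    refine Finset.sum_congr rfl fun j _ => ?_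
    rw [pow_one, one_div]
    congr 1
    push_cast
    ring
  rw [hleft, hright]
  push_cast
  ring

/-! ## The depth-one cell -/

/-- **THE DEPTH-ONE CELL** (`ε ≤ 1`, `k ≤ n`, off the exact centre `2k ≠ n ∨ ε = 0`):
`laurent A B ε n k 1 = cTop A B ε n k·(ε/(n/2 − k) + (A+B)(H_k − H_{n−k}) + B(H_{2n−k} − H_{n+k}))`, i.e.
`c_{k,A−1}(n)/c_{k,A}(n)` is the logarithmic derivative of the regular part of `R_n` at `−k`. -/
theorem laurent_one_eq {A B : ℕ} (hAB : 2 * B ≤ A) {ε n k : ℕ} (hε : ε ≤ 1) (hk : k ≤ n)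
    (hcen : 2 * k ≠ n ∨ ε = 0) :
    laurent A B ε n k 1 = cTop A B ε n k *
      ((ε : ℚ) / ((n : ℚ) / 2 - k) + ((A : ℚ) + B) * (hsum 1 k - hsum 1 (n - k)) +
        (B : ℚ) * (hsum 1 (2 * n - k) - hsum 1 (n + k))) := by
  classical
  set Pn : ℚ[X] := taylor (-(k : ℚ)) (kerNum A B ε n) with hPn
  set Qd : ℚ[X] := taylor (-(k : ℚ)) (kerDenErase A n k) with hQd
  -- the factors and their constant terms
  set c : ℚ := (n : ℚ) / 2 - k with hc
  set Da : ℚ[X] := ∏ m ∈ Icc 1 n, (X + C (-((k : ℚ) + m))) with hDa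
  set Eb : ℚ[X] := ∏ m ∈ Icc 1 n, (X + C ((n : ℚ) + m - k)) with hEb
  set Qf : ℚ[X] := ∏ m ∈ (range (n + 1)).erase k, (X + C ((m : ℚ) - k)) with hQf
  have hra : ∀ m ∈ Icc 1 n, (-((k : ℚ) + m)) ≠ 0 := fun m hm => by
    have := (mem_Icc.1 hm).1; rw [neg_ne_zero]; positivity
  have hrb : ∀ m ∈ Icc 1 n, ((n : ℚ) + m - k) ≠ 0 := fun m hm => by
    have := (mem_Icc.1 hm).1
    have : (k : ℚ) ≤ n := by exact_mod_cast hk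
    have : (1 : ℚ) ≤ m := by exact_mod_cast (mem_Icc.1 hm).1
    linarith
  have hrq : ∀ m ∈ (range (n + 1)).erase k, ((m : ℚ) - k) ≠ 0 := fun m hm => by
    rw [sub_ne_zero]; exact_mod_cast Finset.ne_of_mem_erase hm
  obtain ⟨hDa0, hDa1⟩ := coeff_prod_X_add_C _ _ hra
  obtain ⟨hEb0, hEb1⟩ := coeff_prod_X_add_C _ _ hrb
  obtain ⟨hQf0, hQf1⟩ := coeff_prod_X_add_C _ _ hrq
  rw [← hDa] at hDa0 hDa1
  rw [← hEb] at hEb0 hEb1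
  rw [← hQf] at hQf0 hQf1
  have hDa0' : Da.coeff 0 ≠ 0 := by rw [hDa0]; exact Finset.prod_ne_zero_iff.2 hra
  have hEb0' : Eb.coeff 0 ≠ 0 := by rw [hEb0]; exact Finset.prod_ne_zero_iff.2 hrb
  have hQf0' : Qf.coeff 0 ≠ 0 := by rw [hQf0]; exact Finset.prod_ne_zero_iff.2 hrq
  have hf0 : ((n ! : ℚ)) ^ (A - 2 * B) ≠ 0 := pow_ne_zero _ (by positivity)
  -- the numerator: `Pn₁ = Pn₀·(ε/c + B·Σa + B·Σb)`
  have hPn_eq : Pn = C (((n ! : ℚ)) ^ (A - 2 * B)) * (X + C c) ^ ε * Da ^ B * Eb ^ B := by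
    rw [hPn, taylor_kerNum]
  have hNum : Pn.coeff 1 = Pn.coeff 0 * ((ε : ℚ) / c + (B : ℚ) * ∑ m ∈ Icc 1 n, (-((k : ℚ) + m))⁻¹ +
      (B : ℚ) * ∑ m ∈ Icc 1 n, ((n : ℚ) + m - k)⁻¹) := by
    obtain ⟨hDB0, hDB1⟩ := coeff_one_pow hDa0' B
    obtain ⟨hEB0, hEB1⟩ := coeff_one_pow hEb0' B
    have hDB0' : (Da ^ B).coeff 0 ≠ 0 := by rw [hDB0]; exact pow_ne_zero _ hDa0'
    have hEB0' : (Eb ^ B).coeff 0 ≠ 0 := by rw [hEB0]; exact pow_ne_zero _ hEb0'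
    have hlda : Da.coeff 1 / Da.coeff 0 = ∑ m ∈ Icc 1 n, (-((k : ℚ) + m))⁻¹ := by
      rw [hDa1, hDa0, mul_div_cancel_left₀ _ (Finset.prod_ne_zero_iff.2 hra)]
    have hleb : Eb.coeff 1 / Eb.coeff 0 = ∑ m ∈ Icc 1 n, ((n : ℚ) + m - k)⁻¹ := by
      rw [hEb1, hEb0, mul_div_cancel_left₀ _ (Finset.prod_ne_zero_iff.2 hrb)]
    -- the centre factor `(X + c)^ε`, `ε ∈ {0,1}`
    have hXc : ((C (((n ! : ℚ)) ^ (A - 2 * B)) * (X + C c) ^ ε : ℚ[X])).coeff 0 ≠ 0 ∧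
        ((C (((n ! : ℚ)) ^ (A - 2 * B)) * (X + C c) ^ ε : ℚ[X])).coeff 1 =
          ((C (((n ! : ℚ)) ^ (A - 2 * B)) * (X + C c) ^ ε : ℚ[X])).coeff 0 * ((ε : ℚ) / c) := by
      rcases Nat.le_one_iff_eq_zero_or_eq_one.1 hε with h | h <;> subst h
      · simp only [pow_zero, mul_one, coeff_C_zero, coeff_C_succ, Nat.cast_zero, zero_div, mul_zero]
        exact ⟨hf0, trivial⟩
      · have hc0 : c ≠ 0 := by
          rw [hc]; intro h
          rcases hcen with h2 | h2
          · exact h2 (by exact_mod_cast (by linarith : (2 : ℚ) * k = n))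
          · exact one_ne_zero h2
        simp only [pow_one, coeff_C_mul, coeff_add, coeff_X_zero, coeff_C_zero, zero_add, coeff_X_one, coeff_C_succ,
          add_zero, Nat.cast_one]
        exact ⟨mul_ne_zero hf0 hc0, by field_simp⟩
    have hP3 : ((C (((n ! : ℚ)) ^ (A - 2 * B)) * (X + C c) ^ ε * Da ^ B : ℚ[X])).coeff 0 ≠ 0 := by
      rw [mul_coeff_zero]; exact mul_ne_zero hXc.1 hDB0'
    have hX1 := hXc.1
    rw [hPn_eq, coeff_one_mul hP3 hEB0', coeff_one_mul hXc.1 hDB0', hXc.2, hDB1, hEB1, hlda, hleb]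
    field_simp
  -- the denominator: `Qd₁ = Qd₀·(A·Σd)`
  have hQd_eq : Qd = Qf ^ A := by rw [hQd, taylor_kerDenErase]
  have hDen : Qd.coeff 1 = Qd.coeff 0 * ((A : ℚ) * ∑ m ∈ (range (n + 1)).erase k, ((m : ℚ) - k)⁻¹) := by
    obtain ⟨hQA0, hQA1⟩ := coeff_one_pow hQf0' A
    rw [hQd_eq, hQA1, hQf1, hQf0, mul_div_cancel_left₀ _ (Finset.prod_ne_zero_iff.2 hrq)]
  have hQd0 : Qd.coeff 0 ≠ 0 := by
    rw [hQd, taylor_coeff_zero]; exact eval_kerDenErase_neg_ne_zero A n k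
  -- the Laurent series times the denominator is the numerator
  have hLQ : laurentSeries A B ε n k * (Qd : PowerSeries ℚ) = (Pn : PowerSeries ℚ) := by
    rw [laurentSeries, expandAt, ← hPn, ← hQd, mul_assoc, PowerSeries.inv_mul_cancel _ (by
      rw [Polynomial.constantCoeff_coe]; exact hQd0), mul_one]
  have hL0 : PowerSeries.coeff 0 (laurentSeries A B ε n k) = cTop A B ε n k := laurent_zero hAB ε hk
  have h0 : cTop A B ε n k * Qd.coeff 0 = Pn.coeff 0 := by
    have h := congrArg (PowerSeries.coeff 0) hLQ
    rw [PowerSeries.coeff_mul, Finset.Nat.antidiagonal_zero, Finset.sum_singleton] at h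
    simp only [Polynomial.coeff_coe] at h
    rwa [hL0] at h
  have h1 : cTop A B ε n k * Qd.coeff 1 + laurent A B ε n k 1 * Qd.coeff 0 = Pn.coeff 1 := by
    have h := congrArg (PowerSeries.coeff 1) hLQ
    rw [PowerSeries.coeff_mul, Finset.Nat.sum_antidiagonal_succ, Finset.Nat.antidiagonal_zero,
      Finset.sum_singleton] at h
    simp only [Polynomial.coeff_coe, zero_add] at h
    rw [hL0] at h
    exact h
  -- solve for `laurent … 1`
  have hsol : laurent A B ε n k 1 = cTop A B ε n k * (((ε : ℚ) / c + (B : ℚ) * ∑ m ∈ Icc 1 n, (-((k : ℚ) + m))⁻¹ +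
      (B : ℚ) * ∑ m ∈ Icc 1 n, ((n : ℚ) + m - k)⁻¹) - (A : ℚ) * ∑ m ∈ (range (n + 1)).erase k, ((m : ℚ) - k)⁻¹) := by
    rw [hNum, ← h0, hDen] at h1
    -- `h1 : cTop·(Qd₀·(AΣd)) + laurent₁·Qd₀ = cTop·Qd₀·S_num`; divide by `Qd₀`
    have h1' : (cTop A B ε n k * ((A : ℚ) * ∑ m ∈ (range (n + 1)).erase k, ((m : ℚ) - k)⁻¹) +
        laurent A B ε n k 1) * Qd.coeff 0 = (cTop A B ε n k * ((ε : ℚ) / c +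
          (B : ℚ) * ∑ m ∈ Icc 1 n, (-((k : ℚ) + m))⁻¹ + (B : ℚ) * ∑ m ∈ Icc 1 n, ((n : ℚ) + m - k)⁻¹)) *
          Qd.coeff 0 := by
      linear_combination h1
    have h1'' := mul_right_cancel₀ hQd0 h1'
    linear_combination h1''
  rw [hsol, sum_inv_sub_add_eq hk, sum_inv_sub_eq hk,
    show ∑ m ∈ Icc 1 n, (-((k : ℚ) + m))⁻¹ = -(hsum 1 (n + k) - hsum 1 k) by
      rw [← sum_inv_add_eq, ← Finset.sum_neg_distrib]; exact Finset.sum_congr rfl fun m _ => by rw [inv_neg]]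
  ring

end

end Summit.KontsevichZagierPeriods.Zeta5Search.BrickDepthOneCell
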